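import Literature.Analysis.FluidPDE.MikadoHeatBlocks
import Literature.Analysis.FluidPDE.LerayTensorHolder
import HarnessLib

/-!
# The inverse-cascade blocks `v̄_k(t) = ½N_{k+1}⁻² ℙ div ∑_j A_{j,k+1}|η_j|² e^{-2|η_j|²N_{k+1}²t} a²_{j,k+1} θ_j⊗θ_j`
# of Coiculescu–Palasek (Def. 3.10), their bounds `‖∇ᵐv̄_k‖_∞ ≲ N_{k+1}^{1+m} e^{-N_{k+1}²t}`, and the
# tensor identity `R̄_k(0) = (D_k/c₀)χ²_{k+1} Id + χ²_{k+1} 𝒟ψ⁰_k` of Rmk. 3.12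

Analysis/FluidPDE support file (definitions with proved API; no named facts) on the discharge path of
the principal-parts hypothesis `hA` of
`Literature.Barriers.NavierStokesRegularity.CriticalDataSmoothNonuniqueness_of_principalParts_of_perturbationLe`
(M. P. Coiculescu, S. Palasek, *Non-uniqueness of smooth solutions of the Navier–Stokes equations from
critical data*, Invent. Math. 244 (2025), arXiv:2503.14699). **Def. 3.10**: "the inverse cascade-dominated
evolution `v̄_k(t,x) = ½ N_{k+1}⁻² ℙ div ∑_j A_{j,k+1}|η_j|² e^{-2|η_j|²N_{k+1}²t} a²_{j,k+1}(x) θ_j ⊗ θ_j`";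
proof of **Prop. 3.13**: "`‖∇ᵐv̄_k‖_{L^∞} ≲ ‖∇ᵐv̄_k‖_{C^{β₁}} ≲ N_k^{1+β₁+m} e^{-N_{k+1}²t}`"; §4.1:
"`R̄_k = 2⁻¹N_{k+1}⁻² ∑_j A_{j,k+1}|η_j|² e^{…} a²_{j,k+1} θ_j⊗θ_j` … constructed so that `ℙ div R̄_k = v̄_k`";
**Rmk. 3.12**: "`v̄_k(0,x) = … = c₀⁻¹‖𝒟ψ⁰_k‖ ℙ div(χ_{k+1}(Id + c₀𝒟ψ⁰_k/‖𝒟ψ⁰_k‖)) = ℙ div(χ_{k+1}𝒟ψ⁰_k)`".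
On the unit torus the coefficient is `2π²|η_j|²A_{j,k+1}N_{k+1}⁻²` and the rate `2·4π²N_{k+1}²|η_j|²`.

* `CP25.IterData.cascadeCoeff k j = 2π²|η_j|²A_{j,k+1}/N_{k+1}²`, `ampSqTensor k j = a²_{j,k+1} θ_j⊗θ_j`,
  `Gtensor k = ∑_j cascadeCoeff • ampSqTensor` (`= R̄_k(0)`), `Wfield k j = cascadeCoeff • ℙ div ampSqTensor`,
  `vCascade k t = ∑_j e^{-2 rate_{k+1,j} t} Wfield k j` (`= v̄_k(t)`);
* `CP25.IterData.Admissible.Gtensor_apply_eq` — **the tensor identity of Rmk. 3.12 at level `k`**: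
  `(R̄_k(0))_{ab}(x) = (D_k/c₀) χ_{k+1}(x)² δ_{ab} + χ_{k+1}(x)² (k_{ℓ_k} ⋆ 𝒟g_k)_{ab}(x)` (`sum_ampCoeff_sq_mul`);
* `CP25.IterData.Admissible.vCascade_zero` — `v̄_k(0) = ℙ div R̄_k(0)` (linearity of `ℙ div`);
* `CP25.IterData.Admissible.hasLiftDerivBounds_Wfield` — **(vkbarbounds), all orders, uniform in the level**:
  `HasLiftDerivBounds n (Wfield k j) (C̄w_n N_{k+1}) (4(c̄_{n+2}+cχ_{n+2}) N_{k+1})` — from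
  `hasLiftDerivBounds_lerayTensorDiv` (Hölder loss `L^α`, `α = 1/2`) applied to
  `a²_{j,k+1}θθ ∈ HasLiftDerivBounds (n+2) (4 Camp² N²) (4Λf)` and the scale separation `Λf ≲ N_{k+1}^σ`,
  `σ ≤ 1/2` (so `Λf^{1+α} ≲ N_{k+1}`): this is how the printed `N_k^{1+β₁+m} ≤ N_{k+1}^{1+m}` appears here;
  `hasLiftDerivBounds_vCascade` adds the time factor `e^{-4π²N_{k+1}²t}`;
* structure: `Wfield`, `vCascade k t` are smooth, divergence free and mean zero.

## Mathlib / tree search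

Tree: `CP25.lerayTensorDiv`, `hasLiftDerivBounds_lerayTensorDiv`, `lerayTensorDiv_finset_sum_smul`,
`isDivFree_lerayTensorDiv`, `hasZeroMean_lerayTensorDiv` (`LerayTensorHolder`), `CP25.IterData.rate`,
`hasLiftDerivBounds_amp_succ_sharp`, `Camp` (`MikadoHeatBlocks`), `sum_ampCoeff_sq_mul` (`MikadoDataStep`),
`Λf_le_rpow`, `four_le_Λf`, `norm_tensor_le`, `tensor_symm` (`MikadoDataIteration`).
`lean search 'vCascade|Wfield|inverse cascade'`: nothing prior.

## On the hypothesis `h : I.Admissible`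

`CP25.IterData.Admissible I` (a `structure … : Prop` of `MikadoDataIteration`) bundles the standing
HYPOTHESES on the abstract inputs `I` (profile bounds, unit phases, positive averages, scale relations,
cut-off bounds); the theorems below take `h : I.Admissible` as a section hypothesis (`variable … include h`).
It is not a named fact and nothing here assumes a conclusion: the predicate is PROVED for the paper's
concrete inputs in `CP25.admissible_mkIter` (`MikadoInputs`), which is how these theorems are used.

## References

* M. P. Coiculescu, S. Palasek, Invent. Math. 244 (2025) 165–219, doi:10.1007/s00222-025-01396-z,
  arXiv:2503.14699: Def. 3.10 (`v̄_k`), Rmk. 3.12, Prop. 3.13 (proof, (vkbarbounds)), §4.1 (`R̄_k`).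
  [CoiculescuPalasek2025]
-/

noncomputable section

open Set Function MeasureTheory Filter UnitAddTorus
open scoped BigOperators ContDiff Convolution Topology NNReal

namespace Literature.Analysis.FluidPDE

namespace CP25

open Literature.Analysis.FunctionSpaces Literature.Analysis.FunctionSpaces.Torus

/-- `|η_j|² ≤ 5`. [cite: CoiculescuPalasek2025, §3.1] -/
theorem normSqInt_nashNormal_le (j : Fin 6) : normSqInt (nashNormal j) ≤ 5 := by
  fin_cases j <;> simp [normSqInt, nashNormal, Fin.sum_univ_three] <;> norm_num

/-- `|θ_{ja} θ_{jb}| ≤ 4`. [cite: CoiculescuPalasek2025, Lemma 6.1] -/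
theorem abs_nashDir_mul_le (j : Fin 6) (a b : Fin 3) : |((nashDir j a : ℝ)) * (nashDir j b : ℝ)| ≤ 4 := by
  have h : ∀ i, |(nashDir j i : ℝ)| ≤ 2 := by
    intro i; fin_cases j <;> fin_cases i <;> simp [nashDir]
  rw [abs_mul]
  nlinarith [h a, h b, abs_nonneg ((nashDir j a : ℝ)), abs_nonneg ((nashDir j b : ℝ))]

namespace IterData

variable (I : IterData)

/-! ## The objects -/

/-- **The coefficient `2π²|η_j|² A_{j,k+1} N_{k+1}⁻²`** of `R̄_k` (§4.1; unit-torus normalisation).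
[cite: CoiculescuPalasek2025, Def. 3.10 and §4.1] -/
def cascadeCoeff (k : ℕ) (j : Fin 6) : ℝ :=
  2 * Real.pi ^ 2 * normSqInt (nashNormal j) * I.A (k + 1) j * (((I.N (k + 1) : ℝ)) ^ 2)⁻¹

/-- **The tensor `a²_{j,k+1} θ_j ⊗ θ_j`.** [cite: CoiculescuPalasek2025, Def. 3.10] -/
def ampSqTensor (k : ℕ) (j : Fin 6) (x : UnitAddTorus (Fin 3)) (a b : Fin 3) : ℝ :=
  I.amp (k + 1) j x ^ 2 * (((nashDir j a : ℝ)) * (nashDir j b : ℝ))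

/-- **`R̄_k(0) = ∑_j 2π²|η_j|²A_{j,k+1}N_{k+1}⁻² a²_{j,k+1} θ_j⊗θ_j`.** [cite: CoiculescuPalasek2025, §4.1 (`R̄_k`)] -/
def Gtensor (k : ℕ) (x : UnitAddTorus (Fin 3)) (a b : Fin 3) : ℝ :=
  ∑ j, I.cascadeCoeff k j * I.ampSqTensor k j x a b

/-- **The `j`-th fixed field of the cascade block**: `W_{j,k} = cascadeCoeff • ℙ div (a²_{j,k+1}θ_j⊗θ_j)`.
[cite: CoiculescuPalasek2025, Def. 3.10] -/
def Wfield (k : ℕ) (j : Fin 6) (x : UnitAddTorus (Fin 3)) : EuclideanSpace ℝ (Fin 3) :=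
  I.cascadeCoeff k j • lerayTensorDiv (I.ampSqTensor k j) x

/-- **The inverse-cascade block `v̄_k(t) = ∑_j e^{-2 rate_{k+1,j} t} W_{j,k}`** (Def. 3.10).
[cite: CoiculescuPalasek2025, Def. 3.10] -/
def vCascade (k : ℕ) (t : ℝ) (x : UnitAddTorus (Fin 3)) : EuclideanSpace ℝ (Fin 3) :=
  ∑ j, Real.exp (-(2 * I.rate (k + 1) j * t)) • I.Wfield k j x

/-- `0 ≤ cascadeCoeff` when `A ≥ 0`. [folklore] -/
theorem cascadeCoeff_nonneg (k : ℕ) (j : Fin 6) (hA : 0 ≤ I.A (k + 1) j) : 0 ≤ I.cascadeCoeff k j := by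
  have := normSqInt_nashNormal_pos j
  unfold cascadeCoeff; positivity

end IterData

namespace IterConsts

variable (C : IterConsts)

/-- The uniform constant of the cascade blocks: `C̄w_n = 10π² · 90 K_n · 4 Camp²_{n+2} · 16 c²_{n+2}`,
`K_n = czConstSup (1/2)`, `c_n = c̄_n + cχ_n`. [cite: CoiculescuPalasek2025, Prop. 3.13 (vkbarbounds)] -/
def Cw (n : ℕ) : ℝ :=
  10 * Real.pi ^ 2 * (90 * czConstSup (1 / 2) (by norm_num) (by norm_num) n * (4 * C.Camp (n + 2) ^ 2) *
    (16 * (derivProfileMassSup (Fin 3) (n + 2) + C.cχ (n + 2)) ^ 2))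

end IterConsts

namespace IterData

variable (I : IterData)

namespace Admissible

variable {I} (h : I.Admissible)
include h

/-- `cascadeCoeff ≤ 10π² N_{k+1}⁻²` (`|η_j|² ≤ 5`, `A ≤ 1`). [cite: CoiculescuPalasek2025, Lemma 3.2 (4)] -/
theorem cascadeCoeff_le (k : ℕ) (j : Fin 6) : I.cascadeCoeff k j ≤ 10 * Real.pi ^ 2 * (((I.N (k + 1) : ℝ)) ^ 2)⁻¹ := by
  have hη := normSqInt_nashNormal_le j
  have hη0 := (normSqInt_nashNormal_pos j).le
  have hA1 := h.A_le_one (k + 1) j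
  have hA0 : 0 ≤ I.A (k + 1) j := le_trans h.A₀_pos.le (h.average (k + 1) j)
  have hN : 0 < (((I.N (k + 1) : ℝ)) ^ 2)⁻¹ := by have := h.N_pos' (k + 1); positivity
  unfold cascadeCoeff
  have h1 : normSqInt (nashNormal j) * I.A (k + 1) j ≤ 5 * 1 :=
    mul_le_mul hη hA1 hA0 (by norm_num)
  have hπ : 0 ≤ 2 * Real.pi ^ 2 := by positivity
  nlinarith [mul_le_mul_of_nonneg_left h1 hπ, hN.le, mul_nonneg (mul_nonneg hπ (mul_nonneg hη0 hA0)) hN.le]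

/-- `0 ≤ cascadeCoeff`. [folklore] -/
theorem cascadeCoeff_nonneg' (k : ℕ) (j : Fin 6) : 0 ≤ I.cascadeCoeff k j :=
  I.cascadeCoeff_nonneg k j (le_trans h.A₀_pos.le (h.average (k + 1) j))

/-! ## The tensor identity of Rmk. 3.12 -/

/-- **`R̄_k(0) = (D_k/c₀) χ²_{k+1} Id + χ²_{k+1} (k_{ℓ_k} ⋆ 𝒟g_k)`** entrywise (Rmk. 3.12 before `ℙ div`:
the Nash identity along the field, `sum_ampCoeff_sq_mul`, with `T = k_{ℓ_k} ⋆ 𝒟g_k`, `D = D_k`).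
[cite: CoiculescuPalasek2025, Rmk. 3.12] -/
theorem Gtensor_apply_eq (k : ℕ) (x : UnitAddTorus (Fin 3)) (a b : Fin 3) :
    I.Gtensor k x a b = I.cst.Dseq k / nashRadius * I.χ (k + 1) x ^ 2 * (if a = b then 1 else 0) +
      I.χ (k + 1) x ^ 2 * I.tensor k x a b := by
  have hid := sum_ampCoeff_sq_mul (T := I.tensor k) (D := I.cst.Dseq k) (χ := I.χ (k + 1)) (A := I.A (k + 1))
    (N := I.N (k + 1)) (h.Dseq_pos k) (h.norm_tensor_le k x) (fun a b => h.tensor_symm k x a b)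
    (fun j => lt_of_lt_of_le h.A₀_pos (h.average (k + 1) j)) (h.N_pos (k + 1)) a b
  rw [← hid]
  simp only [Gtensor, cascadeCoeff, ampSqTensor, amp]
  refine Finset.sum_congr rfl fun j _ => ?_
  ring

/-! ## Bounds -/

/-- **`a²_{j,k+1} θ_j⊗θ_j` in the currency**: `HasLiftDerivBounds n (ampSqTensor k j) (4 Camp_n² N_{k+1}²) (4Λf_n(k))`.
[cite: CoiculescuPalasek2025, Prop. 3.13 (abounds)] -/
theorem hasLiftDerivBounds_ampSqTensor (n k : ℕ) (j : Fin 6) :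
    HasLiftDerivBounds n (I.ampSqTensor k j) (4 * (I.cst.Camp n * I.N (k + 1)) ^ 2) (4 * I.Λf n k) := by
  have ha := h.hasLiftDerivBounds_amp_succ_sharp n k j
  have hsq := ha.mul ha
  have hL : 0 ≤ 4 * I.Λf n k := by have := h.Λf_nonneg n k; positivity
  have hC0 : 0 ≤ (I.cst.Camp n * I.N (k + 1)) ^ 2 := sq_nonneg _
  have hentry : ∀ a b, HasLiftDerivBounds n (fun x => I.ampSqTensor k j x a b) (4 * (I.cst.Camp n * I.N (k + 1)) ^ 2)
      (4 * I.Λf n k) := by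
    intro a b
    have h1 := hsq.mul (hasLiftDerivBounds_const (d := Fin 3) n (((nashDir j a : ℝ)) * (nashDir j b : ℝ)) (le_refl (0:ℝ)))
    refine ⟨?_, fun i hi y => ?_⟩
    · have : (fun x => I.ampSqTensor k j x a b) = fun x => (I.amp (k + 1) j x * I.amp (k + 1) j x) * (((nashDir j a : ℝ)) * nashDir j b) := by
        funext x; simp [ampSqTensor, sq]
      rw [this]; exact h1.isSmooth
    · have hb := h1.bound hi y
      have : lift (fun x => I.ampSqTensor k j x a b) = lift fun x => (I.amp (k + 1) j x * I.amp (k + 1) j x) * (((nashDir j a : ℝ)) * nashDir j b) := by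
        funext z; simp [lift_apply, ampSqTensor, sq]
      rw [this]
      refine hb.trans ?_
      rw [add_zero, show 2 * I.Λf n k + 2 * I.Λf n k = 4 * I.Λf n k by ring]
      have hθ := abs_nashDir_mul_le j a b
      rw [Real.norm_eq_abs]
      have hp : 0 ≤ (4 * I.Λf n k) ^ i := pow_nonneg hL i
      have hCN : 0 ≤ I.cst.Camp n * (I.N (k + 1) : ℝ) := by
        have := I.cst.one_le_Camp n; have := (h.N_pos' (k + 1)).le; positivity
      have hCN2 : 0 ≤ I.cst.Camp n * (I.N (k + 1) : ℝ) * (I.cst.Camp n * I.N (k + 1)) := mul_nonneg hCN hCN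
      calc I.cst.Camp n * I.N (k + 1) * (I.cst.Camp n * I.N (k + 1)) * |((nashDir j a : ℝ)) * nashDir j b| * (4 * I.Λf n k) ^ i
          ≤ I.cst.Camp n * I.N (k + 1) * (I.cst.Camp n * I.N (k + 1)) * 4 * (4 * I.Λf n k) ^ i := by
            gcongr
        _ = 4 * (I.cst.Camp n * I.N (k + 1)) ^ 2 * (4 * I.Λf n k) ^ i := by ring
  refine HasLiftDerivBounds.of_pi (fun a => ?_) (by positivity) hL
  exact HasLiftDerivBounds.of_pi (fun b => hentry a b) (by positivity) hL

/-- `ampSqTensor` is smooth. [folklore] -/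
theorem isSmooth_ampSqTensor (k : ℕ) (j : Fin 6) : IsSmooth (I.ampSqTensor k j) :=
  (h.hasLiftDerivBounds_ampSqTensor 0 k j).isSmooth

/-- **The scale separation absorbs the Hölder loss**: with `Λ = 4Λf_n(k)`, `c = c̄_n + cχ_n`, and
`0 ≤ α ≤ 1`: `Λ · Λ^α ≤ 16 c² N_{k+1}` (`Λf ≤ c N^σ`, `σ(1+α) ≤ 1`). [cite: CoiculescuPalasek2025, §2.4 with Prop. 3.13] -/
theorem four_Λf_mul_rpow_le (n k : ℕ) {α : ℝ} (hα0 : 0 ≤ α) (hα1 : α ≤ 1) :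
    (4 * I.Λf n k) * (4 * I.Λf n k) ^ α ≤ 16 * (derivProfileMassSup (Fin 3) n + I.cst.cχ n) ^ 2 * I.N (k + 1) := by
  set c : ℝ := derivProfileMassSup (Fin 3) n + I.cst.cχ n with hc
  set N : ℝ := (I.N (k + 1) : ℝ) with hNdef
  have hc1 : 1 ≤ c := by have := one_le_derivProfileMassSup (d := Fin 3) n; have := h.cχ_nonneg n; rw [hc]; linarith
  have hN1 : 1 ≤ N := by rw [hNdef]; exact_mod_cast h.one_le_N (k + 1)
  have hΛ := h.Λf_le_rpow n k
  have hΛ4 := h.four_le_Λf n k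
  have hΛ1 : 1 ≤ 4 * I.Λf n k := by linarith
  have hσ0 := h.σ_nonneg
  have hσ := h.σ_le_half
  -- `Λ ≤ 4c N^σ`
  have h1 : 4 * I.Λf n k ≤ 4 * c * N ^ I.σ := by rw [hc, hNdef]; linarith
  have hcN : 0 < 4 * c * N ^ I.σ := lt_of_lt_of_le (by linarith) h1
  -- `Λ^α ≤ (4cN^σ)^α ≤ 4cN^σ·?` : use `x^α ≤ x` for `x ≥ 1`, `α ≤ 1`
  have h2 : (4 * I.Λf n k) ^ α ≤ (4 * c * N ^ I.σ) ^ α := Real.rpow_le_rpow (by linarith) h1 hα0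
  have h3 : (4 * c * N ^ I.σ) ^ α ≤ 4 * c * N ^ (I.σ * α) := by
    -- `(4c)^α ≤ 4c` and `(N^σ)^α = N^{σα}`
    rw [Real.mul_rpow (by linarith) (Real.rpow_nonneg (by linarith) _), ← Real.rpow_mul (by linarith)]
    have h4c : (4 * c) ^ α ≤ 4 * c := by
      calc (4 * c) ^ α ≤ (4 * c) ^ (1 : ℝ) := Real.rpow_le_rpow_of_exponent_le (by linarith) hα1
        _ = 4 * c := Real.rpow_one _
    exact mul_le_mul_of_nonneg_right h4c (Real.rpow_nonneg (by linarith) _)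
  -- `N^σ N^{σα} = N^{σ(1+α)} ≤ N`
  have h4 : N ^ I.σ * N ^ (I.σ * α) ≤ N := by
    rw [← Real.rpow_add (by linarith)]
    calc N ^ (I.σ + I.σ * α) ≤ N ^ (1 : ℝ) := by
          refine Real.rpow_le_rpow_of_exponent_le hN1 ?_
          nlinarith
      _ = N := Real.rpow_one _
  calc (4 * I.Λf n k) * (4 * I.Λf n k) ^ α ≤ (4 * c * N ^ I.σ) * (4 * c * N ^ (I.σ * α)) := by
        refine mul_le_mul h1 (h2.trans h3) (Real.rpow_nonneg (by linarith) _) hcN.le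
    _ = 16 * c ^ 2 * (N ^ I.σ * N ^ (I.σ * α)) := by ring
    _ ≤ 16 * c ^ 2 * N := mul_le_mul_of_nonneg_left h4 (by positivity)

/-- **(vkbarbounds), all orders, uniform in the level**: `HasLiftDerivBounds n W_{j,k} (C̄w_n N_{k+1}) (4 c_{n+2} N_{k+1})`
— `‖Dⁱ W_{j,k}‖_∞ ≤ C̄w_n (4c_{n+2})ⁱ N_{k+1}^{1+i}`: the Hölder-loss estimate of `ℙ div(a²θθ)` with `α = 1/2`
followed by the scale separation `Λf^{3/2} ≲ N_{k+1}`. [cite: CoiculescuPalasek2025, Prop. 3.13 (proof, (vkbarbounds))] -/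
theorem hasLiftDerivBounds_Wfield (n k : ℕ) (j : Fin 6) :
    HasLiftDerivBounds n (I.Wfield k j) (I.cst.Cw n * I.N (k + 1))
      (4 * (derivProfileMassSup (Fin 3) (n + 2) + I.cst.cχ (n + 2)) * I.N (k + 1)) := by
  have hα : (0 : ℝ≥0) < 1 / 2 := by norm_num
  have hα1 : (1 / 2 : ℝ≥0) < 1 := by norm_num
  set Λ : ℝ := 4 * I.Λf (n + 2) k with hΛdef
  set c : ℝ := derivProfileMassSup (Fin 3) (n + 2) + I.cst.cχ (n + 2) with hc
  have hΛ1 : 1 ≤ Λ := by have := h.four_le_Λf (n + 2) k; rw [hΛdef]; linarith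
  have hG := h.hasLiftDerivBounds_ampSqTensor (n + 2) k j
  have hP := hasLiftDerivBounds_lerayTensorDiv hα hα1 hG hΛ1
  have hW := hP.const_smul (I.cascadeCoeff k j)
  rw [abs_of_nonneg (h.cascadeCoeff_nonneg' k j)] at hW
  -- frequency: `Λ ≤ 4 c N`
  have hN1 : (1 : ℝ) ≤ I.N (k + 1) := by exact_mod_cast h.one_le_N (k + 1)
  have hfreq : Λ ≤ 4 * c * I.N (k + 1) := by
    have := h.Λf_le (n + 2) k; rw [hΛdef, hc]; linarith
  have hc0 : 0 ≤ 4 * c * (I.N (k + 1) : ℝ) := by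
    have := one_le_derivProfileMassSup (d := Fin 3) (n + 2); have := h.cχ_nonneg (n + 2); rw [hc]; positivity
  refine ⟨hW.isSmooth, fun i hi y => ((hW.mono le_rfl (by linarith) hfreq).bound hi y).trans ?_⟩
  refine mul_le_mul_of_nonneg_right ?_ (pow_nonneg hc0 i)
  -- amplitude: `coeff · 90K · 4Camp²N² · Λ · Λ^{1/2} ≤ Cw N`
  have hcoeff := h.cascadeCoeff_le k j
  have hK : 0 ≤ czConstSup (1 / 2) hα hα1 n := zero_le_one.trans (one_le_czConstSup hα hα1 n)
  have hsep := h.four_Λf_mul_rpow_le (n + 2) k (α := ((1 / 2 : ℝ≥0) : ℝ)) (by norm_num) (by norm_num)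
  have hN0 : (0 : ℝ) < I.N (k + 1) := h.N_pos' (k + 1)
  have hCamp : 0 ≤ I.cst.Camp (n + 2) := zero_le_one.trans (I.cst.one_le_Camp (n + 2))
  have hΛpos : 0 ≤ Λ * Λ ^ (((1 / 2 : ℝ≥0) : ℝ)) := by
    have : 0 ≤ Λ := by linarith
    positivity
  calc I.cascadeCoeff k j * (90 * czConstSup (1 / 2) hα hα1 n * (4 * (I.cst.Camp (n + 2) * I.N (k + 1)) ^ 2) * Λ *
        Λ ^ (((1 / 2 : ℝ≥0) : ℝ)))
      = I.cascadeCoeff k j * (I.N (k + 1) : ℝ) ^ 2 * (90 * czConstSup (1 / 2) hα hα1 n * (4 * I.cst.Camp (n + 2) ^ 2)) *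
          (Λ * Λ ^ (((1 / 2 : ℝ≥0) : ℝ))) := by ring
    _ ≤ (10 * Real.pi ^ 2) * (90 * czConstSup (1 / 2) hα hα1 n * (4 * I.cst.Camp (n + 2) ^ 2)) *
          (16 * c ^ 2 * I.N (k + 1)) := by
        refine mul_le_mul (mul_le_mul_of_nonneg_right ?_ (by positivity)) (by rw [hc]; exact hsep) hΛpos (by positivity)
        calc I.cascadeCoeff k j * (I.N (k + 1) : ℝ) ^ 2 ≤ 10 * Real.pi ^ 2 * (((I.N (k + 1) : ℝ)) ^ 2)⁻¹ * (I.N (k + 1) : ℝ) ^ 2 :=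
              mul_le_mul_of_nonneg_right hcoeff (by positivity)
          _ = 10 * Real.pi ^ 2 := by field_simp
    _ = I.cst.Cw n * I.N (k + 1) := by rw [IterConsts.Cw, hc]; ring

/-- `W_{j,k}` is smooth. [folklore] -/
theorem isSmooth_Wfield (k : ℕ) (j : Fin 6) : IsSmooth (I.Wfield k j) := (h.hasLiftDerivBounds_Wfield 0 k j).isSmooth

/-- **`W_{j,k}` is divergence free.** [cite: CoiculescuPalasek2025, Prop. 3.13 ("`v̄_k` … inside of `ℙ`")] -/
theorem isDivFree_Wfield (k : ℕ) (j : Fin 6) : Torus.IsDivFree (I.Wfield k j) := by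
  intro x
  have hs := isSmooth_lerayTensorDiv (h.isSmooth_ampSqTensor k j)
  unfold Wfield
  rw [show (fun x => I.cascadeCoeff k j • lerayTensorDiv (I.ampSqTensor k j) x) =
    I.cascadeCoeff k j • lerayTensorDiv (I.ampSqTensor k j) from rfl,
    divergence_eq_sum_partialDeriv_apply ((hs.smul _).isContDiff (by simp))]
  simp_rw [partialDeriv_const_smul (hs.isContDiff (by simp))]
  simp only [Pi.smul_apply, PiLp.smul_apply, smul_eq_mul, ← Finset.mul_sum]
  have hdiv := isDivFree_lerayTensorDiv (h.isSmooth_ampSqTensor k j) x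
  rw [divergence_eq_sum_partialDeriv_apply (hs.isContDiff (by simp))] at hdiv
  rw [hdiv, mul_zero]

/-- **`W_{j,k}` has zero mean.** [cite: CoiculescuPalasek2025, Rmk. 3.11 with Def. 3.10] -/
theorem hasZeroMean_Wfield (k : ℕ) (j : Fin 6) : Torus.HasZeroMean (I.Wfield k j) := by
  have h0 := hasZeroMean_lerayTensorDiv (h.isSmooth_ampSqTensor k j)
  unfold Torus.HasZeroMean at h0 ⊢
  unfold Wfield
  rw [integral_smul, h0, smul_zero]

omit h in
/-- The time factor is at most `e^{-4π²N_{k+1}²t}` for `t ≥ 0` (`2 rate ≥ rate ≥ 4π²N²`). [folklore] -/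
theorem exp_neg_two_rate_le (k : ℕ) (j : Fin 6) {t : ℝ} (ht : 0 ≤ t) :
    Real.exp (-(2 * I.rate (k + 1) j * t)) ≤ Real.exp (-(4 * Real.pi ^ 2 * (I.N (k + 1) : ℝ) ^ 2 * t)) := by
  rw [Real.exp_le_exp, neg_le_neg_iff]
  have h1 := I.rate_ge (k + 1) j
  have h2 := I.rate_nonneg (k + 1) j
  nlinarith

/-- **The cascade block with its time factor in the currency**: for `t ≥ 0`,
`HasLiftDerivBounds n (v̄_k(t)) (6 C̄w_n N_{k+1} e^{-4π²N_{k+1}²t}) (4c_{n+2} N_{k+1})`.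
[cite: CoiculescuPalasek2025, Prop. 3.13 (vkbarbounds)] -/
theorem hasLiftDerivBounds_vCascade (n k : ℕ) {t : ℝ} (ht : 0 ≤ t) :
    HasLiftDerivBounds n (I.vCascade k t)
      (6 * (I.cst.Cw n * I.N (k + 1) * Real.exp (-(4 * Real.pi ^ 2 * (I.N (k + 1) : ℝ) ^ 2 * t))))
      (4 * (derivProfileMassSup (Fin 3) (n + 2) + I.cst.cχ (n + 2)) * I.N (k + 1)) := by
  have hL : 0 ≤ 4 * (derivProfileMassSup (Fin 3) (n + 2) + I.cst.cχ (n + 2)) * I.N (k + 1) := by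
    have := one_le_derivProfileMassSup (d := Fin 3) (n + 2); have := h.cχ_nonneg (n + 2); have := (h.N_pos' (k + 1)).le
    positivity
  have hterm : ∀ j ∈ (Finset.univ : Finset (Fin 6)),
      HasLiftDerivBounds n (fun x => Real.exp (-(2 * I.rate (k + 1) j * t)) • I.Wfield k j x)
        (I.cst.Cw n * I.N (k + 1) * Real.exp (-(4 * Real.pi ^ 2 * (I.N (k + 1) : ℝ) ^ 2 * t)))
        (4 * (derivProfileMassSup (Fin 3) (n + 2) + I.cst.cχ (n + 2)) * I.N (k + 1)) := by
    intro j _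
    have h1 := (h.hasLiftDerivBounds_Wfield n k j).const_smul (Real.exp (-(2 * I.rate (k + 1) j * t)))
    refine h1.mono ?_ hL le_rfl
    rw [abs_of_pos (Real.exp_pos _), mul_comm]
    exact mul_le_mul_of_nonneg_left (exp_neg_two_rate_le (I := I) k j ht) (h.hasLiftDerivBounds_Wfield n k j).nonneg
  have hs := HasLiftDerivBounds.sum Finset.univ hterm hL
  rw [Finset.sum_const, Finset.card_univ, Fintype.card_fin] at hs
  simp only [nsmul_eq_mul, Nat.cast_ofNat] at hs
  exact hs

/-- `v̄_k(t)` is smooth (every real `t`). [cite: CoiculescuPalasek2025, §5] -/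
theorem isSmooth_vCascade (k : ℕ) (t : ℝ) : IsSmooth (I.vCascade k t) := by
  have hL : 0 ≤ 4 * (derivProfileMassSup (Fin 3) 2 + I.cst.cχ 2) * I.N (k + 1) := by
    have := one_le_derivProfileMassSup (d := Fin 3) 2; have := h.cχ_nonneg 2; have := (h.N_pos' (k + 1)).le
    positivity
  have hterm : ∀ j ∈ (Finset.univ : Finset (Fin 6)),
      HasLiftDerivBounds 0 (fun x => Real.exp (-(2 * I.rate (k + 1) j * t)) • I.Wfield k j x)
        (|Real.exp (-(2 * I.rate (k + 1) j * t))| * (I.cst.Cw 0 * I.N (k + 1)))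
        (4 * (derivProfileMassSup (Fin 3) 2 + I.cst.cχ 2) * I.N (k + 1)) :=
    fun j _ => (h.hasLiftDerivBounds_Wfield 0 k j).const_smul _
  exact (HasLiftDerivBounds.sum Finset.univ hterm hL).isSmooth

/-- **`v̄_k(t)` is divergence free.** [cite: CoiculescuPalasek2025, Prop. 3.13] -/
theorem isDivFree_vCascade (k : ℕ) (t : ℝ) : Torus.IsDivFree (I.vCascade k t) := by
  intro x
  have h1 : ∀ j, IsContDiff 1 (fun x => Real.exp (-(2 * I.rate (k + 1) j * t)) • I.Wfield k j x) :=
    fun j => ((h.isSmooth_Wfield k j).smul _).isContDiff (by simp)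
  rw [divergence_eq_sum_partialDeriv_apply ((h.isSmooth_vCascade k t).isContDiff (by simp))]
  have hpd : ∀ i, Torus.partialDeriv i (I.vCascade k t) x i =
      ∑ j, Real.exp (-(2 * I.rate (k + 1) j * t)) * Torus.partialDeriv i (I.Wfield k j) x i := by
    intro i
    have hv : I.vCascade k t = fun y => ∑ j ∈ Finset.univ, (fun z => Real.exp (-(2 * I.rate (k + 1) j * t)) • I.Wfield k j z) y := rfl
    rw [hv, partialDeriv_finset_sum Finset.univ (fun j _ => h1 j) i x, WithLp.ofLp_sum, Finset.sum_apply]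
    refine Finset.sum_congr rfl fun j _ => ?_
    rw [show (fun z => Real.exp (-(2 * I.rate (k + 1) j * t)) • I.Wfield k j z) =
        Real.exp (-(2 * I.rate (k + 1) j * t)) • I.Wfield k j from rfl,
      partialDeriv_const_smul ((h.isSmooth_Wfield k j).isContDiff (by simp))]
    rfl
  simp_rw [hpd]
  rw [Finset.sum_comm]
  refine Finset.sum_eq_zero fun j _ => ?_
  rw [← Finset.mul_sum]
  have hdiv := h.isDivFree_Wfield k j x
  rw [divergence_eq_sum_partialDeriv_apply ((h.isSmooth_Wfield k j).isContDiff (by simp))] at hdiv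
  rw [hdiv, mul_zero]

/-- **`v̄_k(t)` has zero mean.** [cite: CoiculescuPalasek2025, Rmk. 3.11] -/
theorem hasZeroMean_vCascade (k : ℕ) (t : ℝ) : Torus.HasZeroMean (I.vCascade k t) := by
  unfold Torus.HasZeroMean
  have hint : ∀ j ∈ (Finset.univ : Finset (Fin 6)),
      Integrable (fun x => Real.exp (-(2 * I.rate (k + 1) j * t)) • I.Wfield k j x) volume :=
    fun j _ => (((h.isSmooth_Wfield k j).smul (Real.exp (-(2 * I.rate (k + 1) j * t)))).continuous).integrable_unitAddTorus
  calc ∫ x, I.vCascade k t x = ∫ x, ∑ j, (fun j y => Real.exp (-(2 * I.rate (k + 1) j * t)) • I.Wfield k j y) j x := rfl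
    _ = ∑ j, ∫ x, (fun j y => Real.exp (-(2 * I.rate (k + 1) j * t)) • I.Wfield k j y) j x := integral_finsetSum _ hint
    _ = 0 := Finset.sum_eq_zero fun j _ => by
        simp only [integral_smul]
        have h0 := h.hasZeroMean_Wfield k j
        unfold Torus.HasZeroMean at h0
        rw [h0, smul_zero]

/-- **At `t = 0`: `v̄_k(0) = ℙ div R̄_k(0)`** (linearity of `ℙ div` over the six summands).
[cite: CoiculescuPalasek2025, §4.1 (`ℙ div R̄_k = v̄_k`) and Rmk. 3.12] -/
theorem vCascade_zero (k : ℕ) (x : UnitAddTorus (Fin 3)) : I.vCascade k 0 x = lerayTensorDiv (I.Gtensor k) x := by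
  simp only [vCascade, mul_zero, neg_zero, Real.exp_zero, one_smul, Wfield]
  rw [show I.Gtensor k = fun y a b => ∑ j ∈ Finset.univ, I.cascadeCoeff k j * I.ampSqTensor k j y a b from rfl,
    lerayTensorDiv_finset_sum_smul Finset.univ (I.cascadeCoeff k) (fun j _ => h.isSmooth_ampSqTensor k j) x]

end Admissible

end IterData

end CP25

end Literature.Analysis.FluidPDE
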